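import Mathlib
import HarnessLib
import Summits.HubbardSuperconductivity.HubbardSuperconductivity.Theorems.KLProgrammeKLRegimeVolumeLimitGridCovariancePeriodisation

/-!
# Route `KLProgramme` — crux K3, the nested two-volume pass (β′): the PERIODISATION HYPOTHESIS (P) of `…TwoVolumeBlockDefect` for the grid-pulled-back
# normal covariance, at EVERY pair of legs (cell gate-hubbard-kl, seat hubbard-kl-k3c4-p1 g7)

`…VolumeLimitGridCovariancePeriodisation.hubbardGridSub_pullback_zero_one_periodise` (p513915) periodises the `(+,−)` entries of
`Sᵀ (normalCovariance p_V) S` (`S = hubbardGridSub V M β N`, symbols `p_V = (βV²)·F ω σ (p_q)`) in the SECOND site.  The near-size theorems of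
`…TwoVolumeBlockDefect` (`norm_near_le`, `sum_norm_near_row_le/col_le`) take (P) at every pair `(X′, Y)`:
`Σ_{Y″ : π Y″ = Y} C′ X′ Y″ = C (π X′) Y`.  Here:

* `periodise_spatialPropagator_left`, `gridPropagator_sum_periodise_left`, **`hubbardGridSub_pullback_zero_one_periodise_left`** — the `(+,−)`
  entries periodise in the FIRST site as well (fibre reflection `sum_fibre_sub_right` of `…TorusPeriodisation`);
* **`hubbardGridSub_pullback_periodise_leg`** — (P) at every pair of legs for any block structure `e` whose projection is
  `(((j, x), σ), c) ↦ (((j, red x), σ), c)` (`…TwoVolumeTorusBlocks.exists_gridLegBlockEquiv`): `(+,−)` by p513915, `(−,+)` by antisymmetry and the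
  left version, equal charges / different spins vanish on both sides;
* `hubbardGridSub_pullback_swap` — the antisymmetry `C′ Y′ X′ = −C′ X′ Y′` in the entrywise form of `…TwoVolumeBlockDefect.norm_near_swap`.

Sorry-free; no definition.  References: BETA-PRIME-ROADMAP.md (m2); BGM 2006 (2.3); `HubbardGridFieldSubstitution` (`gridSub_pullback_normalCovariance_*`).
-/

noncomputable section

namespace Summit.HubbardSuperconductivity.HubbardSuperconductivity.Theorems.TwoPointAssembly

set_option linter.dupNamespace false -- summit = problem name (single-conjunct summit), D-0017

open Finset Complex Literature.MathematicalPhysics.QuantumLattice Literature.Probability.LatticeModels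
open scoped ComplexConjugate

/-! ## §1 The `(+,−)` entries periodise in the FIRST site -/

section Left

variable {b L Lf M : ℕ} [NeZero Lf] [NeZero L]

/-- The spatial propagator of one Matsubara frequency periodises in the FIRST site:
`Σ_{red x′ = x̄′} Lf⁻² Σ_q f(p_q) χ_q(x′ − x) = L⁻² Σ_{q′} f(p_{q′}) χ_{q′}(x̄′ − red x)`. [folklore] -/
theorem periodise_spatialPropagator_left (hLf : Lf = b * L) (f : (Fin 2 → ℝ) → ℂ) (x : TorusSite 2 Lf) (xbar' : TorusSite 2 L) :
    ∑ x' ∈ univ.filter (fun x' : TorusSite 2 Lf => (fun i => (((x' i).val : ℕ) : ZMod L)) = xbar'),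
        ((Lf : ℂ) ^ 2)⁻¹ * ∑ q : TorusSite 2 Lf, f (latticeMomentum Lf q) * torusChar q (x' - x) =
      ((L : ℂ) ^ 2)⁻¹ * ∑ q : TorusSite 2 L, f (latticeMomentum L q) * torusChar q (xbar' - fun i => (((x i).val : ℕ) : ZMod L)) := by
  have hfine : ∀ y : TorusSite 2 Lf, ((Lf : ℂ) ^ 2)⁻¹ * ∑ q : TorusSite 2 Lf, f (latticeMomentum Lf q) * torusChar q y =
      torusFourierInv (fun q : TorusSite 2 Lf => f (latticeMomentum Lf q)) y := fun y => by
    rw [torusFourierInv_eq_sum_torusChar]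
  have hcoarse : ∀ y : TorusSite 2 L, ((L : ℂ) ^ 2)⁻¹ * ∑ q : TorusSite 2 L, f (latticeMomentum L q) * torusChar q y =
      torusFourierInv (fun q : TorusSite 2 L => f (latticeMomentum L q)) y := fun y => by
    rw [torusFourierInv_eq_sum_torusChar]
  simp_rw [hfine, hcoarse]
  rw [sum_fibre_sub_right hLf (torusFourierInv (fun q : TorusSite 2 Lf => f (latticeMomentum Lf q))) x xbar',
    periodise_torusFourierInv_sampled hLf f]

/-- The `(+,−)` summand-sums of `gridSub_pullback_normalCovariance_apply_zero_one` with sampled symbols periodise in the FIRST site. [folklore] -/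
theorem gridPropagator_sum_periodise_left (hLf : Lf = b * L) {β : ℝ} (hβ : β ≠ 0) (F : MatsubaraIdx M → Fin 2 → (Fin 2 → ℝ) → ℂ)
    (pL : FreqMomentum L M × Fin 2 → ℂ) (pLf : FreqMomentum Lf M × Fin 2 → ℂ)
    (hpL : ∀ (k : FreqMomentum L M) (σ : Fin 2), pL (k, σ) = ((β * (L : ℝ) ^ 2 : ℝ) : ℂ) * F k.1 σ (latticeMomentum L k.2))
    (hpLf : ∀ (k : FreqMomentum Lf M) (σ : Fin 2), pLf (k, σ) = ((β * (Lf : ℝ) ^ 2 : ℝ) : ℂ) * F k.1 σ (latticeMomentum Lf k.2))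
    (x : TorusSite 2 Lf) (xbar' : TorusSite 2 L) (τ τ' : ℝ) (σ : Fin 2) :
    ∑ x' ∈ univ.filter (fun x' : TorusSite 2 Lf => (fun i => (((x' i).val : ℕ) : ZMod L)) = xbar'),
        ∑ k : FreqMomentum Lf M, ((1 / (β * (Lf : ℝ) ^ 2) : ℝ) : ℂ) ^ 2 *
          (Complex.exp (((vertexPhase Lf M β k x' τ' - vertexPhase Lf M β k x τ : ℝ) : ℂ) * Complex.I) * pLf (k, σ)) =
      ∑ k : FreqMomentum L M, ((1 / (β * (L : ℝ) ^ 2) : ℝ) : ℂ) ^ 2 *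
        (Complex.exp (((vertexPhase L M β k xbar' τ' - vertexPhase L M β k (fun i => (((x i).val : ℕ) : ZMod L)) τ : ℝ) : ℂ) * Complex.I) *
          pL (k, σ)) := by
  simp_rw [exp_vertexPhase_sub, exp_sum_latticeMomentum_mul_val_sub, hpL, hpLf]
  simp_rw [Fintype.sum_prod_type, sum_gridSummand_eq hβ]
  rw [Finset.sum_comm]
  refine Finset.sum_congr rfl fun ω _ => ?_
  rw [← Finset.mul_sum, periodise_spatialPropagator_left hLf (F ω σ) x xbar']

/-- **The `(+,−)` entries of the grid pull-back periodise in the FIRST site**: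
`Σ_{red x′ = x̄′} (Sᵀ C_{Lf} S)(((j′,x′),σ),+)(((j,x),σ),−) = (Sᵀ C_L S)(((j′,x̄′),σ),+)(((j, red x),σ),−)`. [folklore] -/
theorem hubbardGridSub_pullback_zero_one_periodise_left (hLf : Lf = b * L) {β : ℝ} (hβ : β ≠ 0) (N : ℕ)
    (F : MatsubaraIdx M → Fin 2 → (Fin 2 → ℝ) → ℂ) (pL : FreqMomentum L M × Fin 2 → ℂ) (pLf : FreqMomentum Lf M × Fin 2 → ℂ)
    (hpL : ∀ (k : FreqMomentum L M) (σ : Fin 2), pL (k, σ) = ((β * (L : ℝ) ^ 2 : ℝ) : ℂ) * F k.1 σ (latticeMomentum L k.2))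
    (hpLf : ∀ (k : FreqMomentum Lf M) (σ : Fin 2), pLf (k, σ) = ((β * (Lf : ℝ) ^ 2 : ℝ) : ℂ) * F k.1 σ (latticeMomentum Lf k.2))
    (j j' : Fin N) (x : TorusSite 2 Lf) (xbar' : TorusSite 2 L) (σ : Fin 2) :
    ∑ x' ∈ univ.filter (fun x' : TorusSite 2 Lf => (fun i => (((x' i).val : ℕ) : ZMod L)) = xbar'),
        ((hubbardGridSub Lf M β N).transpose * normalCovariance Lf M pLf * hubbardGridSub Lf M β N) (((j', x'), σ), 0) (((j, x), σ), 1) =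
      ((hubbardGridSub L M β N).transpose * normalCovariance L M pL * hubbardGridSub L M β N)
        (((j', xbar'), σ), 0) (((j, (fun i => (((x i).val : ℕ) : ZMod L))), σ), 1) := by
  simp only [hubbardGridSub, gridSub_pullback_normalCovariance_apply_zero_one, if_true]
  exact gridPropagator_sum_periodise_left hLf hβ F pL pLf hpL hpLf x xbar' (gridTime β N j) (gridTime β N j') σ

end Left

/-! ## §2 (P) at every pair of legs, and the entrywise antisymmetry -/

section Legs

variable {b L Lf M : ℕ} [NeZero Lf] [NeZero L]

/-- Entrywise antisymmetry of the grid pull-back: `C′ Y′ X′ = −C′ X′ Y′` (the `hC't`/`hCt` input of `…TwoVolumeBlockDefect.norm_near_swap`). [folklore] -/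
theorem hubbardGridSub_pullback_swap {V : ℕ} [NeZero V] (β : ℝ) (N : ℕ) (p : FreqMomentum V M × Fin 2 → ℂ) (X' Y' : GridLeg (GridPoint V N)) :
    ((hubbardGridSub V M β N).transpose * normalCovariance V M p * hubbardGridSub V M β N) Y' X' =
      -((hubbardGridSub V M β N).transpose * normalCovariance V M p * hubbardGridSub V M β N) X' Y' := by
  have h := congrFun (congrFun (gridSub_pullback_normalCovariance_transpose (L := V) (M := M) β (fun q : GridPoint V N => q.2)
    (fun q => gridTime β N q.1) p) X') Y'
  rw [Matrix.transpose_apply, Matrix.neg_apply] at h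
  exact h

/-- Equal charges do not contract (grid form of `gridSub_pullback_normalCovariance_apply_of_charge_eq`). [folklore] -/
theorem hubbardGridSub_pullback_apply_of_charge_eq {V : ℕ} [NeZero V] (β : ℝ) (N : ℕ) (p : FreqMomentum V M × Fin 2 → ℂ)
    {Y Y' : GridLeg (GridPoint V N)} (h : Y.2 = Y'.2) :
    ((hubbardGridSub V M β N).transpose * normalCovariance V M p * hubbardGridSub V M β N) Y Y' = 0 := by
  unfold hubbardGridSub
  exact gridSub_pullback_normalCovariance_apply_of_charge_eq _ _ _ _ h

/-- Different spins do not contract (grid form of `gridSub_pullback_normalCovariance_apply_of_spin_ne`). [folklore] -/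
theorem hubbardGridSub_pullback_apply_of_spin_ne {V : ℕ} [NeZero V] (β : ℝ) (N : ℕ) (p : FreqMomentum V M × Fin 2 → ℂ)
    {Y Y' : GridLeg (GridPoint V N)} (h : Y.1.2 ≠ Y'.1.2) :
    ((hubbardGridSub V M β N).transpose * normalCovariance V M p * hubbardGridSub V M β N) Y Y' = 0 := by
  unfold hubbardGridSub
  exact gridSub_pullback_normalCovariance_apply_of_spin_ne _ _ _ _ h

/-- **(P) AT EVERY PAIR OF LEGS.**  For `Lf = b·L`, `β ≠ 0`, sampled symbols `p_V = (βV²)·F` at `V = L, Lf`, and any block structure `e` of the grid legs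
whose projection is `(((j, x), σ), c) ↦ (((j, red x), σ), c)`: the fine grid covariance summed over the fibre of a coarse leg is the coarse grid
covariance — `Σ_{π Y″ = Y} C′ X′ Y″ = C (π X′) Y` (hypothesis `hP` of `…TwoVolumeBlockDefect.norm_near_le`). [folklore] -/
theorem hubbardGridSub_pullback_periodise_leg (hLf : Lf = b * L) {β : ℝ} (hβ : β ≠ 0) (N : ℕ)
    (F : MatsubaraIdx M → Fin 2 → (Fin 2 → ℝ) → ℂ) (pL : FreqMomentum L M × Fin 2 → ℂ) (pLf : FreqMomentum Lf M × Fin 2 → ℂ)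
    (hpL : ∀ (k : FreqMomentum L M) (σ : Fin 2), pL (k, σ) = ((β * (L : ℝ) ^ 2 : ℝ) : ℂ) * F k.1 σ (latticeMomentum L k.2))
    (hpLf : ∀ (k : FreqMomentum Lf M) (σ : Fin 2), pLf (k, σ) = ((β * (Lf : ℝ) ^ 2 : ℝ) : ℂ) * F k.1 σ (latticeMomentum Lf k.2))
    {ι : Type*} (e : GridLeg (GridPoint Lf N) ≃ ι × GridLeg (GridPoint L N))
    (he2 : ∀ X', (e X').2 = (((X'.1.1.1, fun i => (((X'.1.1.2 i).val : ℕ) : ZMod L)), X'.1.2), X'.2))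
    (X' : GridLeg (GridPoint Lf N)) (Y : GridLeg (GridPoint L N)) :
    ∑ Y'' ∈ univ.filter (fun Y'' : GridLeg (GridPoint Lf N) => (e Y'').2 = Y),
        ((hubbardGridSub Lf M β N).transpose * normalCovariance Lf M pLf * hubbardGridSub Lf M β N) X' Y'' =
      ((hubbardGridSub L M β N).transpose * normalCovariance L M pL * hubbardGridSub L M β N) (e X').2 Y := by
  classical
  -- the fibre of the leg `Y` is the site fibre of its site, at the time/spin/charge of `Y`
  have hfib : ∑ Y'' ∈ univ.filter (fun Y'' : GridLeg (GridPoint Lf N) => (e Y'').2 = Y),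
        ((hubbardGridSub Lf M β N).transpose * normalCovariance Lf M pLf * hubbardGridSub Lf M β N) X' Y'' =
      ∑ x' ∈ univ.filter (fun x' : TorusSite 2 Lf => (fun i => (((x' i).val : ℕ) : ZMod L)) = Y.1.1.2),
        ((hubbardGridSub Lf M β N).transpose * normalCovariance Lf M pLf * hubbardGridSub Lf M β N) X' (((Y.1.1.1, x'), Y.1.2), Y.2) := by
    refine Finset.sum_bij' (fun Y'' _ => Y''.1.1.2) (fun x' _ => (((Y.1.1.1, x'), Y.1.2), Y.2)) ?_ ?_ ?_ ?_ ?_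
    · intro Y'' hY''
      simp only [mem_filter, mem_univ, true_and] at hY'' ⊢
      rw [he2] at hY''
      rw [← hY'']
    · intro x' hx'
      simp only [mem_filter, mem_univ, true_and] at hx' ⊢
      rw [he2, hx']
    · intro Y'' hY''
      simp only [mem_filter, mem_univ, true_and] at hY''
      rw [he2] at hY''
      rw [← hY'']
    · intro x' hx'
      rfl
    · intro Y'' hY''
      simp only [mem_filter, mem_univ, true_and] at hY''
      rw [he2] at hY''
      rw [← hY'']
  rw [hfib, he2]
  obtain ⟨⟨⟨j, x⟩, σ⟩, c⟩ := X'
  obtain ⟨⟨⟨j', xbar'⟩, σ'⟩, c'⟩ := Y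
  dsimp only
  -- spins
  by_cases hσ : σ = σ'
  · subst hσ
    -- charges
    by_cases hc : c = c'
    · -- equal charges: both sides vanish
      rw [hubbardGridSub_pullback_apply_of_charge_eq β N pL
        (Y := (((j, fun i => (((x i).val : ℕ) : ZMod L)), σ), c)) (Y' := (((j', xbar'), σ), c')) hc]
      exact sum_eq_zero fun x' _ => hubbardGridSub_pullback_apply_of_charge_eq β N pLf hc
    · fin_cases c <;> fin_cases c'
      · exact absurd rfl hc
      · -- `(+,−)`: p513915
        exact hubbardGridSub_pullback_zero_one_periodise hLf hβ N F pL pLf hpL hpLf j j' x xbar' σ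
      · -- `(−,+)`: antisymmetry + the left version
        have h1 : ∀ x' : TorusSite 2 Lf,
            ((hubbardGridSub Lf M β N).transpose * normalCovariance Lf M pLf * hubbardGridSub Lf M β N) (((j, x), σ), 1) (((j', x'), σ), 0) =
              -((hubbardGridSub Lf M β N).transpose * normalCovariance Lf M pLf * hubbardGridSub Lf M β N) (((j', x'), σ), 0) (((j, x), σ), 1) :=
          fun x' => hubbardGridSub_pullback_swap β N pLf _ _
        simp only [Fin.isValue, Fin.mk_one, Fin.zero_eta] at h1 ⊢
        simp_rw [h1]
        rw [Finset.sum_neg_distrib, hubbardGridSub_pullback_zero_one_periodise_left hLf hβ N F pL pLf hpL hpLf j j' x xbar' σ,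
          ← hubbardGridSub_pullback_swap β N pL]
      · exact absurd rfl hc
  · -- different spins: both sides vanish
    rw [hubbardGridSub_pullback_apply_of_spin_ne β N pL
      (Y := (((j, fun i => (((x i).val : ℕ) : ZMod L)), σ), c)) (Y' := (((j', xbar'), σ'), c')) hσ]
    exact sum_eq_zero fun x' _ => hubbardGridSub_pullback_apply_of_spin_ne β N pLf hσ

end Legs

end Summit.HubbardSuperconductivity.HubbardSuperconductivity.Theorems.TwoPointAssembly

end
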